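import Summits.AtomisticToContinuum.Crystallization.Theorems.FrustratedLawDichotomyCoherentWindow

/-!
# FrustratedLawDichotomy · crux `AperiodicFrustratedLawGap` (stmt-AtomisticToContinuum-27623) — COHERENCE ON A GENERAL WINDOW
# (hdef side, class H «halo» rows: the (189) `…CoherentSets` / NODE-13 `…CoherentWindow` dictionary with the ball `closedBall 0 R` replaced by an
# arbitrary measurable window `W`; decomp-a2c hand-1 g52, preparing the class-H door «CoherentFloorHalo» (window = ball ∩ half-space))

`coherentOn a τ W = {μ | every template ball closedBall x τ, x ∈ a, carries mass} ∩ {μ | μ (W ∖ ⋃_{x∈a} closedBall x τ) = 0}` — for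
`W = closedBall 0 R` this is LITERALLY `coherentAt a τ R` (`coherentAt_eq_coherentOn`, `rfl`).  For a class-H root the window is the part of the
`Rc`-ball on the known side of a plane; beyond the plane the configuration is unknown (vacancy cluster, wall, class-D matter).

* `measurableSet_coherentOn` (W measurable) — rows built from it are measurable (T3/T4 `hK`);
* `count_restrict_mem_coherentOn_iff(')`, `nonempty_of_mem_coherentOn`;
* `inter_subset_image_atomOf_of_coherentOn` / `inter_eq_image_atomOf_of_coherentOn` (template balls inside `W`) — the window's atoms ARE the
  template-indexed atoms `atomOf S τ '' a`; `restrict_eq_count_image_of_coherentOn`;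
* ★ `setIntegral_eq_sum_atomOf_of_coherentOn` — `∫ z in W, f z ∂(count⌊S) = Σ_{x∈a} f (atomOf S τ x)` for EVERY `f`.
One plain `def`; imports TREE (219) `…CoherentWindow` only; 0 sorry.  All `[folklore]`.
-/

noncomputable section

namespace Summit.AtomisticToContinuum.Crystallization.Theorems.FrustratedLawDichotomyCoherentOn

open MeasureTheory Metric Set
open scoped ENNReal
open Summit.AtomisticToContinuum.Crystallization.Theorems.ChargedEnergyGapNegative (E3)
open Summit.AtomisticToContinuum.Crystallization.Theorems.FrustratedLawDichotomyCoherentSets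
open Summit.AtomisticToContinuum.Crystallization.Theorems.FrustratedLawDichotomyCoherentWindow

/-- **Coherence on a window `W`.**  `μ ∈ coherentOn a τ W` iff every ball `closedBall x τ` (`x ∈ a`) has positive `μ`-mass and `W` carries no
`μ`-mass outside `⋃ x ∈ a, closedBall x τ`. -/
def coherentOn (a : Finset E3) (τ : ℝ) (W : Set E3) : Set (Measure E3) :=
  (⋂ x ∈ a, {μ : Measure E3 | μ (closedBall x τ) ≠ 0}) ∩ {μ : Measure E3 | μ (W \ ⋃ x ∈ a, closedBall x τ) = 0}

/-- The ball case is (189)'s `coherentAt`, by `rfl`. [folklore] -/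
theorem coherentAt_eq_coherentOn (a : Finset E3) (τ R : ℝ) : coherentAt a τ R = coherentOn a τ (closedBall (0 : E3) R) := rfl

/-- Membership, unfolded. [folklore] -/
theorem mem_coherentOn_iff (a : Finset E3) (τ : ℝ) (W : Set E3) (μ : Measure E3) :
    μ ∈ coherentOn a τ W ↔ (∀ x ∈ a, μ (closedBall x τ) ≠ 0) ∧ μ (W \ ⋃ x ∈ a, closedBall x τ) = 0 := by
  simp only [coherentOn, mem_inter_iff, mem_iInter, mem_setOf_eq]

/-- The window region outside the template balls is measurable. [folklore] -/
theorem measurableSet_window_diff' (a : Finset E3) (τ : ℝ) {W : Set E3} (hW : MeasurableSet W) :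
    MeasurableSet (W \ ⋃ x ∈ a, closedBall x τ) :=
  hW.diff (Finset.measurableSet_biUnion a fun _ _ => measurableSet_closedBall)

/-- `coherentOn a τ W` is a measurable set of configurations (W measurable). [folklore] -/
theorem measurableSet_coherentOn (a : Finset E3) (τ : ℝ) {W : Set E3} (hW : MeasurableSet W) : MeasurableSet (coherentOn a τ W) := by
  refine (Finset.measurableSet_biInter a fun x _ => ?_).inter ?_
  · exact (Measure.measurable_coe measurableSet_closedBall) (measurableSet_singleton 0).compl
  · exact (Measure.measurable_coe (measurableSet_window_diff' a τ hW)) (measurableSet_singleton 0)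

/-- Monotone in the window: coherence on `W` implies coherence on every `W' ⊆ W`. [folklore] -/
theorem coherentOn_anti (a : Finset E3) (τ : ℝ) {W W' : Set E3} (h : W' ⊆ W) : coherentOn a τ W ⊆ coherentOn a τ W' := by
  intro μ hμ
  rw [mem_coherentOn_iff] at hμ ⊢
  exact ⟨hμ.1, measure_mono_null (sdiff_le_sdiff_right h) hμ.2⟩

/-- **Membership for configurations** `count⌊S`: every template ball meets `S`, and no atom of `W` lies outside the template balls. [folklore] -/
theorem count_restrict_mem_coherentOn_iff (S : Set E3) (a : Finset E3) (τ : ℝ) {W : Set E3} (hW : MeasurableSet W) :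
    (Measure.count.restrict S : Measure E3) ∈ coherentOn a τ W ↔
      (∀ x ∈ a, (closedBall x τ ∩ S).Nonempty) ∧ (W \ ⋃ x ∈ a, closedBall x τ) ∩ S = ∅ := by
  rw [mem_coherentOn_iff]
  refine and_congr (forall₂_congr fun x _ => ?_) ?_
  · rw [Measure.restrict_apply measurableSet_closedBall, Measure.count_ne_zero_iff]
  · rw [Measure.restrict_apply (measurableSet_window_diff' a τ hW), Measure.count_eq_zero_iff]

/-- The same with the second clause as an inclusion. [folklore] -/
theorem count_restrict_mem_coherentOn_iff' (S : Set E3) (a : Finset E3) (τ : ℝ) {W : Set E3} (hW : MeasurableSet W) :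
    (Measure.count.restrict S : Measure E3) ∈ coherentOn a τ W ↔
      (∀ x ∈ a, (closedBall x τ ∩ S).Nonempty) ∧ S ∩ W ⊆ ⋃ x ∈ a, closedBall x τ := by
  rw [count_restrict_mem_coherentOn_iff S a τ hW]
  refine and_congr Iff.rfl ⟨fun h p hp => ?_, fun h => ?_⟩
  · by_contra hne
    have : p ∈ (W \ ⋃ x ∈ a, closedBall x τ) ∩ S := ⟨⟨hp.2, hne⟩, hp.1⟩
    rw [h] at this
    exact this
  · exact eq_empty_of_forall_notMem fun p hp => hp.1.2 (h ⟨hp.2, hp.1.1⟩)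

variable {S : Set E3} {δ τ : ℝ} {a : Finset E3} {W : Set E3}

/-- Under coherence every template ball meets `S`. [folklore] -/
theorem nonempty_of_mem_coherentOn (hW : MeasurableSet W) (h : (Measure.count.restrict S : Measure E3) ∈ coherentOn a τ W) {x : E3}
    (hx : x ∈ a) : (closedBall x τ ∩ S).Nonempty :=
  ((count_restrict_mem_coherentOn_iff S a τ hW).1 h).1 x hx

/-- **Window ⊆ template atoms.** [folklore] -/
theorem inter_subset_image_atomOf_of_coherentOn (hS : ∀ p ∈ S, ∀ p' ∈ S, p ≠ p' → δ ≤ dist p p') (hτ : 2 * τ < δ)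
    (hW : MeasurableSet W) (h : (Measure.count.restrict S : Measure E3) ∈ coherentOn a τ W) :
    S ∩ W ⊆ atomOf S τ '' (a : Set E3) := by
  intro p hp
  have hcov := ((count_restrict_mem_coherentOn_iff' S a τ hW).1 h).2 hp
  simp only [mem_iUnion, exists_prop] at hcov
  obtain ⟨x, hx, hpx⟩ := hcov
  exact ⟨x, hx, (eq_atomOf_of_mem hS hτ ⟨hpx, hp.1⟩).symm⟩

/-- **Window = template atoms** when every template ball lies inside the window. [folklore] -/
theorem inter_eq_image_atomOf_of_coherentOn (hS : ∀ p ∈ S, ∀ p' ∈ S, p ≠ p' → δ ≤ dist p p') (hτ : 2 * τ < δ)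
    (hW : MeasurableSet W) (h : (Measure.count.restrict S : Measure E3) ∈ coherentOn a τ W) (hin : ∀ x ∈ a, closedBall x τ ⊆ W) :
    S ∩ W = atomOf S τ '' (a : Set E3) := by
  refine (inter_subset_image_atomOf_of_coherentOn hS hτ hW h).antisymm ?_
  rintro _ ⟨x, hx, rfl⟩
  have hm := atomOf_mem (nonempty_of_mem_coherentOn hW h (Finset.mem_coe.1 hx))
  exact ⟨hm.2, hin x (Finset.mem_coe.1 hx) hm.1⟩

/-- The same with the image as a `Finset`. [folklore] -/
theorem inter_eq_coe_image_of_coherentOn (hS : ∀ p ∈ S, ∀ p' ∈ S, p ≠ p' → δ ≤ dist p p') (hτ : 2 * τ < δ)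
    (hW : MeasurableSet W) (h : (Measure.count.restrict S : Measure E3) ∈ coherentOn a τ W) (hin : ∀ x ∈ a, closedBall x τ ⊆ W) :
    S ∩ W = ((a.image (atomOf S τ) : Finset E3) : Set E3) := by
  classical
  rw [Finset.coe_image]
  exact inter_eq_image_atomOf_of_coherentOn hS hτ hW h hin

/-- **The configuration restricted to the window is the counting measure of the template-indexed atoms.** [folklore] -/
theorem restrict_eq_count_image_of_coherentOn (hS : ∀ p ∈ S, ∀ p' ∈ S, p ≠ p' → δ ≤ dist p p') (hτ : 2 * τ < δ)
    (hW : MeasurableSet W) (h : (Measure.count.restrict S : Measure E3) ∈ coherentOn a τ W) (hin : ∀ x ∈ a, closedBall x τ ⊆ W) :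
    (Measure.count.restrict S : Measure E3).restrict W = Measure.count.restrict (((a.image (atomOf S τ) : Finset E3) : Set E3)) := by
  classical
  rw [Measure.restrict_restrict hW, Set.inter_comm, inter_eq_coe_image_of_coherentOn hS hτ hW h hin]

/-- ★ **WINDOW FUNCTIONALS ARE TEMPLATE SUMS**: for every `f : E3 → ℝ`, `∫ z in W, f z ∂(count⌊S) = Σ_{x∈a} f (atomOf S τ x)` (template
points pairwise `> 2τ` apart). [folklore] -/
theorem setIntegral_eq_sum_atomOf_of_coherentOn (hS : ∀ p ∈ S, ∀ p' ∈ S, p ≠ p' → δ ≤ dist p p') (hτ : 2 * τ < δ)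
    (hW : MeasurableSet W) (h : (Measure.count.restrict S : Measure E3) ∈ coherentOn a τ W) (hin : ∀ x ∈ a, closedBall x τ ⊆ W)
    (ha : ∀ x ∈ a, ∀ x' ∈ a, x ≠ x' → 2 * τ < dist x x') (f : E3 → ℝ) :
    ∫ z in W, f z ∂(Measure.count.restrict S : Measure E3) = ∑ x ∈ a, f (atomOf S τ x) := by
  classical
  rw [restrict_eq_count_image_of_coherentOn hS hτ hW h hin,
    Literature.MathematicalPhysics.StatisticalMechanics.integral_count_restrict_coe_finset,
    Finset.sum_image fun x hx x' hx' hxx' => injOn_atomOf ha (fun y hy => nonempty_of_mem_coherentOn hW h hy) hx hx' hxx']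

/-- The window's atoms form a finite set (image of the template). [folklore] -/
theorem finite_inter_of_coherentOn (hS : ∀ p ∈ S, ∀ p' ∈ S, p ≠ p' → δ ≤ dist p p') (hτ : 2 * τ < δ)
    (hW : MeasurableSet W) (h : (Measure.count.restrict S : Measure E3) ∈ coherentOn a τ W) : (S ∩ W).Finite :=
  ((a : Set E3).toFinite.image _).subset (inter_subset_image_atomOf_of_coherentOn hS hτ hW h)

/-- A template ball `closedBall x τ` lies inside the ball window when `‖x‖ + τ ≤ R`. [folklore] -/
theorem closedBall_subset_closedBall_zero {x : E3} {R : ℝ} (hx : ‖x‖ + τ ≤ R) : closedBall x τ ⊆ closedBall (0 : E3) R := by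
  intro z hz
  rw [mem_closedBall_zero_iff]
  have h1 : ‖z - x‖ ≤ τ := by rw [← dist_eq_norm]; exact mem_closedBall.mp hz
  calc ‖z‖ = ‖x + (z - x)‖ := by rw [add_sub_cancel]
    _ ≤ ‖x‖ + ‖z - x‖ := norm_add_le _ _
    _ ≤ R := by linarith

/-- A template ball lies inside the half-space `{z | ⟪z, n⟫ ≤ s}` when `⟪x, n⟫ + τ ≤ s` (`‖n‖ = 1`). [folklore] -/
theorem closedBall_subset_halfSpace {x n : E3} (hn : ‖n‖ = 1) {s : ℝ} (hx : inner ℝ x n + τ ≤ s) :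
    closedBall x τ ⊆ {z : E3 | inner ℝ z n ≤ s} := by
  intro z hz
  rw [mem_setOf_eq]
  have h1 : ‖z - x‖ ≤ τ := by rw [← dist_eq_norm]; exact mem_closedBall.mp hz
  have h2 : inner ℝ (z - x) n ≤ ‖z - x‖ := by
    have := abs_real_inner_le_norm (z - x) n
    rw [hn, mul_one] at this
    exact (le_abs_self _).trans this
  have h3 : inner ℝ z n = inner ℝ x n + inner ℝ (z - x) n := by rw [← inner_add_left, add_sub_cancel]
  linarith

end Summit.AtomisticToContinuum.Crystallization.Theorems.FrustratedLawDichotomyCoherentOn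

end
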